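import Literature.MathematicalPhysics.QuantumManyBody.LiebYngvasonPoincare
import HarnessLib

/-!
# Crux `OneBodyEntropyBound` (stmt-AtomisticToContinuum-13440), line `registered`: stub `stub_cubeNeumannBound`
# — the local Neumann bound on a cube with an obstacle of positive volume

Support file (`--supports stmt-AtomisticToContinuum-13440`, worker W-G1 of lead c2). For `ℓ, c, σ₀ > 0` there is an
`ε₀ = ε₀(ℓ, c, σ₀) > 0` such that for every open coordinate cube `U = a + (0,ℓ)³ ⊂ ℝ³`, every measurable `Sh ⊆ U`
with `|Sh| ≥ σ₀` and every compactly supported `C¹` function `φ : ℝ³ → ℂ`,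
`ε₀ ∫_U |φ|² ≤ ∫_U Σ_k |∂_k φ|² + c ∫_{Sh} |φ|²` (no boundary condition on `∂U`), i.e. the lowest Neumann eigenvalue
of `-Δ + c·1_{Sh}` on `U` is bounded below uniformly in the position of the cube and the shape of the obstacle.
It is consumed (as an inlined hypothesis) by the one-body caging bound of the same skeleton.

## Proof

The cube Poincaré inequality `Poincare.isPoincare_space` on `(0,ℓ)³`, transported to `a + (0,ℓ)³` by the
measure-preserving translation `x ↦ x + a` (`fderiv` commutes with translations), gives
`D := ∫_U |φ - m|² ≤ P·K` with `P = (ℓ/π)²`, `K = ∫_U Σ_k |∂_k φ|²` and `m` the mean of `φ` over `U`. With the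
pointwise bounds `|φ|² ≤ 2|φ - m|² + 2|m|²` (on `U`) and `|m|² ≤ 2|φ|² + 2|φ - m|²` (on `Sh`):
`∫_U |φ|² ≤ 2D + 2ℓ³|m|²` and `σ₀|m|² ≤ |Sh|·|m|² ≤ 2∫_{Sh}|φ|² + 2D`, whence
`∫_U |φ|² ≤ (2 + 4ℓ³/σ₀)·P·K + (4ℓ³/σ₀)·∫_{Sh}|φ|²`, and `ε₀ = min (1/((2 + 4ℓ³/σ₀)P)) (cσ₀/(4ℓ³))` works.
Everything is proved for Bochner integrals of bounded continuous functions on sets of finite measure and converted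
to the `ℝ≥0∞` form at the end (`Poincare.ofReal_norm_sq`). Elementary; `[folklore]` throughout.
-/

noncomputable section

namespace Summit.AtomisticToContinuum.BoseEinsteinCondensation.Cruxes.OneBodyEntropyBound.Birth

open MeasureTheory Set Filter Metric
open scoped ENNReal NNReal Real
open Literature.MathematicalPhysics.QuantumManyBody.BoseGas
open Literature.MathematicalPhysics.QuantumManyBody.BoseGas.Poincare

namespace CubeNeumann

/-- `(· + a)⁻¹' (a + (0,ℓ)³) = (0,ℓ)³`: the open coordinate cube at `a` is the translate of the box `Λ_ℓ`.
[folklore] -/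
theorem preimage_add_cubeAt (a : Space) (ℓ : ℝ) :
    (fun x => x + a) ⁻¹' {x : Space | ∀ k, x k ∈ Ioo (a k) (a k + ℓ)} = box ℓ := by
  ext x
  simp only [mem_preimage, mem_setOf_eq, box, PiLp.add_apply, mem_Ioo]
  refine forall_congr' fun k => ?_
  constructor <;> rintro ⟨h1, h2⟩ <;> constructor <;> linarith

/-- The open coordinate cube at `a` is the preimage under `ofLp` of the product of the intervals
`(a_k, a_k + ℓ)`. [folklore] -/
theorem cubeAt_eq_preimage_pi (a : Space) (ℓ : ℝ) :
    {x : Space | ∀ k, x k ∈ Ioo (a k) (a k + ℓ)} =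
      (WithLp.ofLp : Space → (Fin 3 → ℝ)) ⁻¹' (univ.pi fun k => Ioo (a k) (a k + ℓ)) := by
  ext x
  simp only [mem_setOf_eq, mem_preimage, mem_univ_pi]

/-- The open coordinate cube at `a` is measurable. [folklore] -/
theorem measurableSet_cubeAt (a : Space) (ℓ : ℝ) :
    MeasurableSet {x : Space | ∀ k, x k ∈ Ioo (a k) (a k + ℓ)} := by
  rw [cubeAt_eq_preimage_pi]
  exact (MeasurableSet.univ_pi fun k => measurableSet_Ioo).preimage
    (PiLp.volume_preserving_ofLp (Fin 3)).measurable

/-- `|a + (0,ℓ)³| = ℓ³`. [folklore] -/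
theorem volume_cubeAt (a : Space) {ℓ : ℝ} (hℓ : 0 ≤ ℓ) :
    volume {x : Space | ∀ k, x k ∈ Ioo (a k) (a k + ℓ)} = ENNReal.ofReal (ℓ ^ 3) := by
  rw [cubeAt_eq_preimage_pi, (PiLp.volume_preserving_ofLp (Fin 3)).measure_preimage
    (MeasurableSet.univ_pi fun _ => measurableSet_Ioo).nullMeasurableSet, volume_pi_pi]
  simp only [Real.volume_Ioo, add_sub_cancel_left, Finset.prod_const, Finset.card_univ,
    Fintype.card_fin, ENNReal.ofReal_pow hℓ]

/-- Translating set integrals: `∫_{(0,ℓ)³} g(x + a) dx = ∫_{a + (0,ℓ)³} g(x) dx` (Lebesgue measure is translation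
invariant). [folklore] -/
theorem setIntegral_box_comp_add {G : Type*} [NormedAddCommGroup G] [NormedSpace ℝ G]
    (a : Space) (ℓ : ℝ) (g : Space → G) :
    ∫ x in box ℓ, g (x + a) = ∫ x in {x : Space | ∀ k, x k ∈ Ioo (a k) (a k + ℓ)}, g x := by
  rw [← preimage_add_cubeAt a ℓ]
  exact (measurePreserving_add_right (volume : Measure Space) a).setIntegral_preimage_emb
    (measurableEmbedding_addRight a) g _

/-- `‖u‖² ≤ 2‖u - m‖² + 2‖m‖²`. [folklore] -/
theorem norm_sq_le_two_mul_add (u m : ℂ) : ‖u‖ ^ 2 ≤ 2 * ‖u - m‖ ^ 2 + 2 * ‖m‖ ^ 2 := by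
  have h := norm_add_le (u - m) m
  rw [sub_add_cancel] at h
  have h2 : ‖u‖ ^ 2 ≤ (‖u - m‖ + ‖m‖) ^ 2 := pow_le_pow_left₀ (norm_nonneg _) h 2
  nlinarith [sq_nonneg (‖u - m‖ - ‖m‖)]

/-- `‖m‖² ≤ 2‖u‖² + 2‖u - m‖²`. [folklore] -/
theorem norm_sq_le_two_mul_add' (u m : ℂ) : ‖m‖ ^ 2 ≤ 2 * ‖u‖ ^ 2 + 2 * ‖u - m‖ ^ 2 := by
  have h := norm_sub_le u (u - m)
  rw [sub_sub_cancel] at h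
  have h2 : ‖m‖ ^ 2 ≤ (‖u‖ + ‖u - m‖) ^ 2 := pow_le_pow_left₀ (norm_nonneg _) h 2
  nlinarith [sq_nonneg (‖u - m‖ - ‖u‖)]

end CubeNeumann

open CubeNeumann in
/-- **Local Neumann bound on a cube** (stub `stub_cubeNeumannBound` of the skeleton, verbatim
`Sig.stub_cubeNeumannBound`): for `ℓ, c, σ₀ > 0` there is `ε₀ > 0` such that for every open coordinate cube
`U = a + (0,ℓ)³`, every measurable `Sh ⊆ U` with `|Sh| ≥ σ₀` and every compactly supported `C¹` map `φ : ℝ³ → ℂ`,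
`ε₀ ∫_U |φ|² ≤ ∫_U Σ_k |∂_k φ|² + c ∫_{Sh} |φ|²`. One may take
`ε₀ = min (1 / ((2 + 4ℓ³/σ₀)(ℓ/π)²)) (c σ₀ / (4ℓ³))`. [folklore] -/
theorem stub_cubeNeumannBound :
    ∀ (ℓ c σ₀ : ℝ), 0 < ℓ → 0 < c → 0 < σ₀ → ∃ ε₀ : ℝ, 0 < ε₀ ∧
      ∀ (a : EuclideanSpace ℝ (Fin 3)) (Sh : Set (EuclideanSpace ℝ (Fin 3))), MeasurableSet Sh →
        Sh ⊆ {x | ∀ k, x k ∈ Set.Ioo (a k) (a k + ℓ)} → ENNReal.ofReal σ₀ ≤ MeasureTheory.volume Sh →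
        ∀ φ : EuclideanSpace ℝ (Fin 3) → ℂ, ContDiff ℝ 1 φ → HasCompactSupport φ →
          ENNReal.ofReal ε₀ * ∫⁻ x in {x | ∀ k, x k ∈ Set.Ioo (a k) (a k + ℓ)}, (‖φ x‖₊ : ENNReal) ^ 2 ≤
            (∫⁻ x in {x | ∀ k, x k ∈ Set.Ioo (a k) (a k + ℓ)},
                ∑ k : Fin 3, (‖fderiv ℝ φ x (EuclideanSpace.single k (1 : ℝ))‖₊ : ENNReal) ^ 2) +
              ENNReal.ofReal c * ∫⁻ x in Sh, (‖φ x‖₊ : ENNReal) ^ 2 := by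
  intro ℓ c σ₀ hℓ hc hσ₀
  -- the constants
  set P : ℝ := (ℓ / π) ^ 2 with hP
  set V : ℝ := ℓ ^ 3 with hV
  have hP0 : 0 < P := by positivity
  have hV0 : 0 < V := by positivity
  set A : ℝ := (2 + 4 * V / σ₀) * P with hA
  set B : ℝ := 4 * V / σ₀ with hB
  have hA0 : 0 < A := by positivity
  have hB0 : 0 < B := by positivity
  refine ⟨min (1 / A) (c / B), lt_min (by positivity) (by positivity), ?_⟩
  intro a Sh hShm hShU hσSh φ hφ hφs
  set ε₀ : ℝ := min (1 / A) (c / B) with hε₀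
  have hε₀0 : 0 < ε₀ := lt_min (by positivity) (by positivity)
  set U : Set Space := {x | ∀ k, x k ∈ Set.Ioo (a k) (a k + ℓ)} with hU
  -- measure-theoretic facts on `U` and `Sh`
  have hUvol : volume U = ENNReal.ofReal V := volume_cubeAt a hℓ.le
  have hUfin : volume U ≠ ⊤ := by rw [hUvol]; exact ENNReal.ofReal_ne_top
  have hShfin : volume Sh ≠ ⊤ := ne_top_of_le_ne_top hUfin (measure_mono hShU)
  haveI : IsFiniteMeasure (volume.restrict U) := isFiniteMeasure_restrict.2 hUfin
  haveI : IsFiniteMeasure (volume.restrict Sh) := isFiniteMeasure_restrict.2 hShfin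
  have hUreal : (volume.restrict U).real univ = V := by
    rw [measureReal_def, Measure.restrict_apply_univ, hUvol, ENNReal.toReal_ofReal hV0.le]
  have hShreal : σ₀ ≤ (volume.restrict Sh).real univ := by
    rw [measureReal_def, Measure.restrict_apply_univ]
    exact (ENNReal.ofReal_le_iff_le_toReal hShfin).1 hσSh
  -- bounds on `φ` and `∇φ`
  have hφc : Continuous φ := hφ.continuous
  obtain ⟨C, hC⟩ := hφs.exists_bound_of_continuous hφc
  obtain ⟨C', hC'⟩ :=
    (hφs.fderiv (𝕜 := ℝ)).exists_bound_of_continuous (hφ.continuous_fderiv one_ne_zero)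
  -- notation
  set e : Fin 3 → Space := fun k => EuclideanSpace.single k (1 : ℝ) with he
  set F : Space → ℝ := fun x => ∑ k, ‖fderiv ℝ φ x (e k)‖ ^ 2 with hF
  have hFc : Continuous F := continuous_finsetSum _ fun k _ =>
    (((hφ.continuous_fderiv one_ne_zero).clm_apply continuous_const).norm.pow 2)
  -- the Poincaré inequality on the translated cube
  set f : Space → ℂ := fun x => φ (x + a) with hf
  have hfd : ∀ x, fderiv ℝ f x = fderiv ℝ φ (x + a) := fun x => fderiv_comp_add_right a
  have hfB : BddC1 f :=
    ⟨hφ.comp (contDiff_id.add contDiff_const), ⟨C, fun x => hC _⟩,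
      ⟨C', fun x => by rw [hfd]; exact hC' _⟩⟩
  have h := isPoincare_space (E := ℂ) hℓ f hfB
  set m : ℂ := ⨍ y in box ℓ, f y with hm
  have h1 : ∫ x in box ℓ, ‖f x - m‖ ^ 2 = ∫ x in U, ‖φ x - m‖ ^ 2 :=
    setIntegral_box_comp_add a ℓ (fun x => ‖φ x - m‖ ^ 2)
  have h2 : ∫ x in box ℓ, ∑ k, ‖fderiv ℝ f x (e k)‖ ^ 2 = ∫ x in U, F x := by
    simp only [hfd]
    exact setIntegral_box_comp_add a ℓ F
  have key : ∫ x in U, ‖φ x - m‖ ^ 2 ≤ P * ∫ x in U, F x := by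
    calc ∫ x in U, ‖φ x - m‖ ^ 2 = ∫ x in box ℓ, ‖f x - m‖ ^ 2 := h1.symm
      _ ≤ (ℓ / π) ^ 2 * ∫ x in box ℓ, ∑ k, ‖fderiv ℝ f x (e k)‖ ^ 2 := h
      _ = P * ∫ x in U, F x := by rw [h2]
  -- integrability on `U` and on `Sh`
  have hbN : ∀ x, ‖‖φ x‖ ^ 2‖ ≤ C ^ 2 := fun x => by
    rw [norm_pow, norm_norm]
    exact pow_le_pow_left₀ (norm_nonneg _) (hC x) 2
  have hbD : ∀ x, ‖‖φ x - m‖ ^ 2‖ ≤ (C + ‖m‖) ^ 2 := fun x => by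
    rw [norm_pow, norm_norm]
    exact pow_le_pow_left₀ (norm_nonneg _) ((norm_sub_le _ _).trans (by gcongr; exact hC x)) 2
  have hmN : AEStronglyMeasurable (fun x => ‖φ x‖ ^ 2) volume :=
    (hφc.norm.pow 2).aestronglyMeasurable
  have hmD : AEStronglyMeasurable (fun x => ‖φ x - m‖ ^ 2) volume :=
    ((hφc.sub continuous_const).norm.pow 2).aestronglyMeasurable
  have hiNU : Integrable (fun x => ‖φ x‖ ^ 2) (volume.restrict U) :=
    integrable_of_norm_le hmN.restrict hbN
  have hiNS : Integrable (fun x => ‖φ x‖ ^ 2) (volume.restrict Sh) :=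
    integrable_of_norm_le hmN.restrict hbN
  have hiDU : Integrable (fun x => ‖φ x - m‖ ^ 2) (volume.restrict U) :=
    integrable_of_norm_le hmD.restrict hbD
  have hiDS : Integrable (fun x => ‖φ x - m‖ ^ 2) (volume.restrict Sh) :=
    integrable_of_norm_le hmD.restrict hbD
  have hiFU : Integrable F (volume.restrict U) := by
    refine integrable_of_norm_le hFc.aestronglyMeasurable (C := ∑ k : Fin 3, (C' * ‖e k‖) ^ 2)
      fun x => ?_
    rw [Real.norm_of_nonneg (by positivity)]
    exact Finset.sum_le_sum fun k _ => norm_apply_sq_le (hC' x) (e k)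
  -- the real quantities
  set N : ℝ := ∫ x in U, ‖φ x‖ ^ 2 with hN
  set D : ℝ := ∫ x in U, ‖φ x - m‖ ^ 2 with hD
  set K : ℝ := ∫ x in U, F x with hK
  set S : ℝ := ∫ x in Sh, ‖φ x‖ ^ 2 with hS
  set DS : ℝ := ∫ x in Sh, ‖φ x - m‖ ^ 2 with hDS
  have hK0 : 0 ≤ K := integral_nonneg fun x => by positivity
  have hS0 : 0 ≤ S := integral_nonneg fun x => by positivity
  -- `∫_U |φ|² ≤ 2 D + 2 V |m|²`
  have hNle : N ≤ 2 * D + 2 * V * ‖m‖ ^ 2 := by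
    calc N ≤ ∫ x in U, (2 * ‖φ x - m‖ ^ 2 + 2 * ‖m‖ ^ 2) :=
          integral_mono hiNU ((hiDU.const_mul 2).add (integrable_const _))
            fun x => norm_sq_le_two_mul_add (φ x) m
      _ = 2 * D + 2 * V * ‖m‖ ^ 2 := by
          rw [integral_add (hiDU.const_mul 2) (integrable_const _), integral_const_mul, integral_const,
            hUreal, smul_eq_mul]
          ring
  -- `|Sh| |m|² ≤ 2 ∫_{Sh} |φ|² + 2 D`
  have hSle : (volume.restrict Sh).real univ * ‖m‖ ^ 2 ≤ 2 * S + 2 * DS := by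
    calc (volume.restrict Sh).real univ * ‖m‖ ^ 2 = ∫ x in Sh, ‖m‖ ^ 2 := by
          rw [integral_const, smul_eq_mul]
      _ ≤ ∫ x in Sh, (2 * ‖φ x‖ ^ 2 + 2 * ‖φ x - m‖ ^ 2) :=
          integral_mono (integrable_const _) ((hiNS.const_mul 2).add (hiDS.const_mul 2))
            fun x => norm_sq_le_two_mul_add' (φ x) m
      _ = 2 * S + 2 * DS := by
          rw [integral_add (hiNS.const_mul 2) (hiDS.const_mul 2), integral_const_mul,
            integral_const_mul]
  have hDSle : DS ≤ D :=
    setIntegral_mono_set hiDU (ae_of_all _ fun x => by positivity) hShU.eventuallyLE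
  have hm2 : σ₀ * ‖m‖ ^ 2 ≤ 2 * S + 2 * D := by
    calc σ₀ * ‖m‖ ^ 2 ≤ (volume.restrict Sh).real univ * ‖m‖ ^ 2 :=
          mul_le_mul_of_nonneg_right hShreal (sq_nonneg _)
      _ ≤ 2 * S + 2 * DS := hSle
      _ ≤ 2 * S + 2 * D := by linarith
  -- the real-variable inequality
  have hNAB : N ≤ A * K + B * S := by
    have h3 : ‖m‖ ^ 2 ≤ (2 * S + 2 * D) / σ₀ := by
      rw [le_div_iff₀ hσ₀]; linarith
    calc N ≤ 2 * D + 2 * V * ‖m‖ ^ 2 := hNle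
      _ ≤ 2 * D + 2 * V * ((2 * S + 2 * D) / σ₀) := by gcongr
      _ = (2 + 4 * V / σ₀) * D + (4 * V / σ₀) * S := by
          field_simp
          ring
      _ ≤ (2 + 4 * V / σ₀) * (P * K) + (4 * V / σ₀) * S := by gcongr
      _ = A * K + B * S := by rw [hA, hB]; ring
  have hfinal : ε₀ * N ≤ K + c * S := by
    have hεA : ε₀ * A ≤ 1 := by
      calc ε₀ * A ≤ (1 / A) * A := mul_le_mul_of_nonneg_right (min_le_left _ _) hA0.le
        _ = 1 := by field_simp
    have hεB : ε₀ * B ≤ c := by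
      calc ε₀ * B ≤ (c / B) * B := mul_le_mul_of_nonneg_right (min_le_right _ _) hB0.le
        _ = c := by field_simp
    calc ε₀ * N ≤ ε₀ * (A * K + B * S) := mul_le_mul_of_nonneg_left hNAB hε₀0.le
      _ = (ε₀ * A) * K + (ε₀ * B) * S := by ring
      _ ≤ 1 * K + c * S :=
          add_le_add (mul_le_mul_of_nonneg_right hεA hK0) (mul_le_mul_of_nonneg_right hεB hS0)
      _ = K + c * S := by ring
  -- conversion to `ℝ≥0∞`
  have e1 : ∫⁻ x in U, (‖φ x‖₊ : ℝ≥0∞) ^ 2 = ENNReal.ofReal N := by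
    rw [hN, ofReal_integral_eq_lintegral_ofReal hiNU (ae_of_all _ fun x => by positivity)]
    exact lintegral_congr fun x => (ofReal_norm_sq _).symm
  have e2 : ∫⁻ x in U, ∑ k, (‖fderiv ℝ φ x (e k)‖₊ : ℝ≥0∞) ^ 2 = ENNReal.ofReal K := by
    rw [hK, ofReal_integral_eq_lintegral_ofReal hiFU (ae_of_all _ fun x => by positivity)]
    refine lintegral_congr fun x => ?_
    rw [hF]
    dsimp only
    rw [ENNReal.ofReal_sum_of_nonneg (fun k _ => by positivity)]
    simp_rw [ofReal_norm_sq]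
  have e3 : ∫⁻ x in Sh, (‖φ x‖₊ : ℝ≥0∞) ^ 2 = ENNReal.ofReal S := by
    rw [hS, ofReal_integral_eq_lintegral_ofReal hiNS (ae_of_all _ fun x => by positivity)]
    exact lintegral_congr fun x => (ofReal_norm_sq _).symm
  rw [e1, e2, e3, ← ENNReal.ofReal_mul hε₀0.le, ← ENNReal.ofReal_mul hc.le,
    ← ENNReal.ofReal_add hK0 (by positivity)]
  exact ENNReal.ofReal_le_ofReal hfinal

end Summit.AtomisticToContinuum.BoseEinsteinCondensation.Cruxes.OneBodyEntropyBound.Birth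

end
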